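import Summits.AtomisticToContinuum.FouriersLaw.Theses.EmbeddedDrudeMourre
import Literature.MathematicalPhysics.KineticTheory.ZeroWavenumberSpace
import Literature.MathematicalPhysics.KineticTheory.InfiniteChainSuperstableDynamics
import Literature.MathematicalPhysics.KineticTheory.InfiniteChainAbelWitness
import HarnessLib

/-!
# `EmbeddedDrudeMourre.MourreDissolution`, line `separable-vertex-faddeev-pair-sector` —
# stub `stub_fgrPositivity` (S7) from the kinetic Green–Kubo statement by Abel summation
# (`--supports` stmt-AtomisticToContinuum-12594, lead c2, helper stub `stub_fgrPositivity_of_kineticGreenKubo`)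

Item `stmt-AtomisticToContinuum-12594` (crux `MourreDissolution` of route `EmbeddedDrudeMourre`,
sub-problem `FouriersLaw`), registered stub `stub_fgrPositivity` (S7) of the line skeleton
`Cruxes/MourreDissolution/Lines/separable_vertex_faddeev_pair_sector.lean`: a uniform positive floor
`c ≤ A_T(ν) := ∫₀^∞ e^{−νt} C_T(t) dt` for all `ν ∈ (0, ν₀)`, `C_T = D.currentCorrelation Z.μ` the summed
current autocorrelation of a canonical zero-wavenumber datum `(D, Z)` of `pinnedChain ω₂ lam β γ` at small
`T`. As stated S7 is the lower-bound half of the Green–Kubo conjecture (open). This file records its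
CONDITIONAL DISCHARGE from the kinetic Green–Kubo statement (K) — verbatim the registered stub
`stub_kineticGreenKubo` of the sibling crux stmt-AtomisticToContinuum-12593 (line `Sketch`): on a corner
`T < T₀`, for every `(D, Z)` with `D.carrier = bmGood` and `Z.μ` DLR-Gibbs at `T`,
`C_T ∈ L¹(0,∞)` and `0 < I := ∫₀^∞ C_T`.

Proof (`stub_fgrPositivity_of_kineticGreenKubo`): Abel summation of an `L¹` function
(`tendsto_abel_of_integrableOn`, dominated convergence: `A_T(ν) → I` as `ν ↓ 0`), so `A_T(ν) ≥ I/2`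
eventually along `𝓝[>] 0` (`eventually_ge_nhds`), i.e. on some `(0, ν₀)`
(`mem_nhdsGT_iff_exists_Ioo_subset`); witness `c := I/2`. The gap hypothesis `HasOddSectorGap` and the
superstability / momentum-reversal / strong-continuity hypotheses of S7 are not used. (K) in turn is
implied, for the canonical datum, by the target `KineticCornerGreenKubo` of route `KineticCorner`
(stmt-AtomisticToContinuum-3429; bridge `…MourreDissolutionOfKineticCorner.lean`).
-/

noncomputable section

open MeasureTheory Filter Set
open scoped Topology

namespace Summit.AtomisticToContinuum.FouriersLaw.Theorems.MourreDissolution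

open Literature.MathematicalPhysics.KineticTheory.HeatConduction

/-- **S7 ⇐ (K): the uniform Abel floor of `C_T` from the kinetic Green–Kubo statement.** If on a corner
`T < T₀` every canonical zero-wavenumber datum `(D, Z)` of `pinnedChain ω₂ lam β γ` (carrier `bmGood`,
`Z.μ` DLR-Gibbs at `T`) has `C_T ∈ L¹(0,∞)` with `0 < I := ∫₀^∞ C_T` (hypothesis (K), verbatim the
registered `stub_kineticGreenKubo` of stmt-12593), then the registered stub `stub_fgrPositivity` (S7) of
stmt-12594 holds with the same `T₀`, `c := I/2` and some `ν₀ > 0`: `A_T(ν) = ∫₀^∞ e^{−νt} C_T(t) dt → I`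
as `ν ↓ 0` by Abel summation of an `L¹` function (`tendsto_abel_of_integrableOn`, dominated convergence),
hence `A_T(ν) ≥ I/2` on some `(0, ν₀)`. [folklore] -/
theorem stub_fgrPositivity_of_kineticGreenKubo :
    (∀ ω₂ lam β γ : ℝ, 0 < ω₂ → 0 < lam → 0 < β → 0 < γ → ∃ T₀ : ℝ, 0 < T₀ ∧
      ∀ T : ℝ, 0 < T → T < T₀ →
        ∀ (D : Literature.MathematicalPhysics.KineticTheory.HeatConduction.InfiniteChainDynamics
              (Literature.MathematicalPhysics.KineticTheory.HeatConduction.pinnedChain ω₂ lam β γ))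
          (Z : Literature.MathematicalPhysics.KineticTheory.HeatConduction.ZeroWavenumberData
              (Literature.MathematicalPhysics.KineticTheory.HeatConduction.pinnedChain ω₂ lam β γ) D),
          D.carrier =
            (Literature.MathematicalPhysics.KineticTheory.HeatConduction.pinnedChain ω₂ lam β γ).bmGood →
          (Literature.MathematicalPhysics.KineticTheory.HeatConduction.pinnedChain
              ω₂ lam β γ).IsChainGibbsMeasure T Z.μ →
          MeasureTheory.IntegrableOn (D.currentCorrelation Z.μ) (Set.Ioi 0) ∧
            0 < ∫ t in Set.Ioi (0 : ℝ), D.currentCorrelation Z.μ t) →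
    ∀ ω₂ lam β γ : ℝ, 0 < ω₂ → 0 < lam → 0 < β → 0 < γ →
      Literature.MathematicalPhysics.KineticTheory.PhononBoltzmann.HasOddSectorGap ω₂ lam β →
      ∃ T₀ : ℝ, 0 < T₀ ∧ ∀ T : ℝ, 0 < T → T < T₀ →
        ∀ (D : Literature.MathematicalPhysics.KineticTheory.HeatConduction.InfiniteChainDynamics
            (Literature.MathematicalPhysics.KineticTheory.HeatConduction.pinnedChain ω₂ lam β γ))
          (Z : Literature.MathematicalPhysics.KineticTheory.HeatConduction.ZeroWavenumberData
            (Literature.MathematicalPhysics.KineticTheory.HeatConduction.pinnedChain ω₂ lam β γ) D),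
          D.carrier =
              (Literature.MathematicalPhysics.KineticTheory.HeatConduction.pinnedChain
                ω₂ lam β γ).bmGood →
          (Literature.MathematicalPhysics.KineticTheory.HeatConduction.pinnedChain
              ω₂ lam β γ).IsChainGibbsMeasure T Z.μ →
          (Literature.MathematicalPhysics.KineticTheory.HeatConduction.pinnedChain
              ω₂ lam β γ).HasSuperstabilityEstimate Z.μ →
          Z.HasMomentumReversal →
          (∀ ψ : Literature.MathematicalPhysics.KineticTheory.HeatConduction.ZeroWavenumberSpace Z,
            Continuous fun t : ℝ => Z.koopman t ψ) →
          ∃ c ν₀ : ℝ, 0 < c ∧ 0 < ν₀ ∧ ∀ ν : ℝ, 0 < ν → ν < ν₀ →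
            c ≤ MeasureTheory.integral (MeasureTheory.volume.restrict (Set.Ioi (0:ℝ)))
              (fun t : ℝ => Real.exp (-(ν * t)) * D.currentCorrelation Z.μ t) := by
  intro hK ω₂ lam β γ hω hl hβ hγ _
  obtain ⟨T₀, hT₀, hT⟩ := hK ω₂ lam β γ hω hl hβ hγ
  refine ⟨T₀, hT₀, fun T hTpos hTlt D Z hD hG _ _ _ => ?_⟩
  obtain ⟨hint, hpos⟩ := hT T hTpos hTlt D Z hD hG
  -- Abel summation: `A_T(ν) → I := ∫₀^∞ C_T` as `ν ↓ 0`, hence `A_T(ν) ≥ I/2` on some `(0, ν₀)`.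
  have hev : ∀ᶠ ν in 𝓝[>] (0 : ℝ), (∫ t in Set.Ioi (0 : ℝ), D.currentCorrelation Z.μ t) / 2 ≤
      ∫ t in Set.Ioi (0 : ℝ), Real.exp (-(ν * t)) * D.currentCorrelation Z.μ t :=
    (tendsto_abel_of_integrableOn hint).eventually (eventually_ge_nhds (half_lt_self hpos))
  obtain ⟨ν₀, hν₀, hsub⟩ := mem_nhdsGT_iff_exists_Ioo_subset.1 hev
  exact ⟨_, ν₀, half_pos hpos, hν₀, fun ν hν hνlt => hsub ⟨hν, hνlt⟩⟩

end Summit.AtomisticToContinuum.FouriersLaw.Theorems.MourreDissolution
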